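import Literature.Algebra.Homology.OrderedCechSystemCupLeibniz
import Literature.Algebra.Homology.BilinearMapHomology
import HarnessLib

/-!
# The ordered Čech cup product on COHOMOLOGY: the three descent hypotheses
# (Godement II §6.6; Görtz–Wedhorn II (21.29); Cartan–Eilenberg IV.6)

Sequel to `Algebra/Homology/OrderedCechSystemCupLeibniz` (Leibniz rule `d(f ∪ g) = df ∪ g + (-1)^p f ∪ dg` for the cup
product `cup β p q n` of ordered Čech cochains of systems of `A`-modules along a natural pairing `β`) and
`Algebra/Homology/BilinearMapHomology` (the generic descent `bilinearHomologyMap` of a cochain-level pairing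
`φ : Cᵖ ⊗ Dᵠ ⟶ Eⁿ` to `Hᵖ(C) ⊗ Hᵠ(D) ⟶ Hⁿ(E)` under three hypotheses (h1)–(h3)).  THEOREMS ONLY: for the pairing

  `φ_cup := ModuleCat.ofHom (TensorProduct.lift (cup β p q n)) : Čᵖ(M) ⊗ Čᵠ(N) ⟶ Čⁿ(P)`

on the ordered Čech complexes `OrderedCech.sysComplex`, with `p + q = n`, `p, q ≥ 0`:

* `cupPairing_cycles` — (h1) `(ι ⊗ ι) ≫ φ_cup ≫ d = 0` (cocycles cup to cocycles);
* `cupPairing_boundary_left` — (h2) `(d ▷ Zᵠ) ≫ (Čᵖ ◁ ι) ≫ φ_cup = ψ₁ ≫ d` with `ψ₁ = (Čᵖ⁰ ◁ ι) ≫ φ_cup` in degrees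
  `(p₀, q, n₀)` (`(d e) ∪ g = d (e ∪ g)` for a cocycle `g`);
* `cupPairing_boundary_right` — (h3) `(Zᵖ ◁ d) ≫ (ι ▷ Čᵠ) ≫ φ_cup = ψ₂ ≫ d` with
  `ψ₂ = (-1)^p • (ι ▷ Čᵠ⁰) ≫ φ_cup` (`f ∪ (d e) = (-1)^p d (f ∪ e)` for a cocycle `f`).

Hence every consumer forms **the cup product on cohomology** in one line,
`bilinearHomologyMap Č(M) Č(N) Č(P) hp hq hn φ_cup (cupPairing_cycles …) _ (cupPairing_boundary_left …) _
(cupPairing_boundary_right …) : Hᵖ ⊗ Hᵠ ⟶ Hⁿ`, characterised by `(π ⊗ π) ≫ – = ([z ∪ w])` and onto as soon as every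
`n`-cocycle is a sum of cups of cocycles up to a coboundary (`bilinearHomologyMap_surjective_of`).  No new definition
here (the packet's DEF files are `OrderedCechSystemCup` and `BilinearMapHomology`).  Library only (cell hodgecm-mathlib,
FLOOR-0 P1 F-11 road A, jobs J3/J4-(iv)); HC_CM is proved only modulo the 7 printed citations until rung 0 closes,
and nothing here bears on it.

## References

* [Godement1958] R. Godement, *Topologie algébrique et théorie des faisceaux* (1958), II §6.6 (the cup product passes to
  cohomology).
* [GortzWedhorn2023] U. Görtz, T. Wedhorn, *Algebraic Geometry II* (2023), (21.29).
* [CartanEilenberg1956] H. Cartan, S. Eilenberg, *Homological Algebra* (1956), IV.6.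
-/

universe u

open CategoryTheory CategoryTheory.Limits CategoryTheory.MonoidalCategory HomologicalComplex TensorProduct

set_option backward.isDefEq.respectTransparency false

noncomputable section

namespace Literature.Algebra.Homology

namespace OrderedCech

variable {ι : Type} [LinearOrder ι] {A : Type u} [CommRing A] {M N P : Finset ι ⥤ ModuleCat.{u} A}
  {β : ∀ s : Finset ι, M.obj s →ₗ[A] N.obj s →ₗ[A] P.obj s}

/-- In negative degree the ordered Čech cochains are trivial. [folklore] [cite: GortzWedhorn2023, Def. 21.68 (p. 180)] -/
theorem subsingleton_sysCochain_of_neg (M : Finset ι ⥤ ModuleCat.{u} A) {n : ℤ} (hn : n < 0) :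
    Subsingleton (SysCochain M n) := by
  haveI : IsEmpty (Simplex ι n) := isEmpty_simplex_of_neg hn
  exact inferInstanceAs (Subsingleton (∀ σ : Simplex ι n, M.obj σ.1))

/-- **(h1) cocycles cup to cocycles**: `(ι ⊗ ι) ≫ φ_cup ≫ d = 0` on `Zᵖ(M) ⊗ Zᵠ(N)` (`p, q ≥ 0`, `p + q = n`).
[cite: Godement1958, II §6.6] -/
theorem cupPairing_cycles (hβ : IsNaturalPairing β) {p q n : ℤ} (hp : 0 ≤ p) (hq : 0 ≤ q) (hpq : p + q = n) :
    ((sysComplex M).iCycles p ⊗ₘ (sysComplex N).iCycles q) ≫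
      (ModuleCat.ofHom (lift (cup β p q n)) : (sysComplex M).X p ⊗ (sysComplex N).X q ⟶ (sysComplex P).X n) ≫
        (sysComplex P).d n (n + 1) = 0 := by
  rw [sysComplex_d]
  apply ModuleCat.hom_ext
  apply TensorProduct.ext'
  intro z w
  change sysD P n (cup β p q n (((sysComplex M).iCycles p).hom z) (((sysComplex N).iCycles q).hom w)) = 0
  have hz : sysD M p (((sysComplex M).iCycles p).hom z) = 0 := by
    have h := (sysComplex M).iCycles_d p (p + 1)
    rw [sysComplex_d] at h
    exact congrArg (fun f => f.hom z) h
  have hw : sysD N q (((sysComplex N).iCycles q).hom w) = 0 := by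
    have h := (sysComplex N).iCycles_d q (q + 1)
    rw [sysComplex_d] at h
    exact congrArg (fun f => f.hom w) h
  exact sysD_cup_eq_zero hβ hp hq hpq hz hw

/-- **(h2) the cup of a coboundary with a cocycle is a coboundary, naturally**:
`(d ▷ Zᵠ) ≫ (Čᵖ ◁ ι) ≫ φ_cup(p,q,n) = ((Čᵖ⁰ ◁ ι) ≫ φ_cup(p₀,q,n₀)) ≫ d` for `p₀ + 1 = p`, `n₀ + 1 = n`, `q ≥ 0`,
`p + q = n`. [cite: Godement1958, II §6.6] -/
theorem cupPairing_boundary_left (hβ : IsNaturalPairing β) {p₀ p q n₀ n : ℤ} (hp : p₀ + 1 = p) (hn : n₀ + 1 = n)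
    (hq : 0 ≤ q) (hpq : p + q = n) :
    ((sysComplex M).d p₀ p ▷ (sysComplex N).cycles q) ≫ ((sysComplex M).X p ◁ (sysComplex N).iCycles q) ≫
      (ModuleCat.ofHom (lift (cup β p q n)) : (sysComplex M).X p ⊗ (sysComplex N).X q ⟶ (sysComplex P).X n) =
      (((sysComplex M).X p₀ ◁ (sysComplex N).iCycles q) ≫
        (ModuleCat.ofHom (lift (cup β p₀ q n₀)) :
          (sysComplex M).X p₀ ⊗ (sysComplex N).X q ⟶ (sysComplex P).X n₀)) ≫ (sysComplex P).d n₀ n := by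
  subst hp hn
  rw [sysComplex_d, sysComplex_d]
  apply ModuleCat.hom_ext
  apply TensorProduct.ext'
  intro e w
  change cup β (p₀ + 1) q (n₀ + 1) (sysD M p₀ e) (((sysComplex N).iCycles q).hom w) =
    sysD P n₀ (cup β p₀ q n₀ e (((sysComplex N).iCycles q).hom w))
  by_cases hp₀ : 0 ≤ p₀
  · have hw : sysD N q (((sysComplex N).iCycles q).hom w) = 0 := by
      have h := (sysComplex N).iCycles_d q (q + 1)
      rw [sysComplex_d] at h
      exact congrArg (fun f => f.hom w) h
    exact cup_sysD_left hβ hp₀ hq (by omega) e hw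
  · haveI : Subsingleton ((sysComplex M).X p₀) := subsingleton_sysCochain_of_neg M (show p₀ < 0 by omega)
    rw [Subsingleton.elim e 0, map_zero, map_zero, LinearMap.zero_apply, map_zero, LinearMap.zero_apply, map_zero]

/-- **(h3) the cup of a cocycle with a coboundary is a coboundary, naturally**:
`(Zᵖ ◁ d) ≫ (ι ▷ Čᵠ) ≫ φ_cup(p,q,n) = ((-1)^p • (ι ▷ Čᵠ⁰) ≫ φ_cup(p,q₀,n₀)) ≫ d` for `q₀ + 1 = q`, `n₀ + 1 = n`,
`p ≥ 0`, `p + q = n`. [cite: Godement1958, II §6.6] -/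
theorem cupPairing_boundary_right (hβ : IsNaturalPairing β) {p q₀ q n₀ n : ℤ} (hq : q₀ + 1 = q) (hn : n₀ + 1 = n)
    (hp : 0 ≤ p) (hpq : p + q = n) :
    ((sysComplex M).cycles p ◁ (sysComplex N).d q₀ q) ≫ ((sysComplex M).iCycles p ▷ (sysComplex N).X q) ≫
      (ModuleCat.ofHom (lift (cup β p q n)) : (sysComplex M).X p ⊗ (sysComplex N).X q ⟶ (sysComplex P).X n) =
      (((-1 : A) ^ p.toNat) • (((sysComplex M).iCycles p ▷ (sysComplex N).X q₀) ≫
        (ModuleCat.ofHom (lift (cup β p q₀ n₀)) :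
          (sysComplex M).X p ⊗ (sysComplex N).X q₀ ⟶ (sysComplex P).X n₀))) ≫ (sysComplex P).d n₀ n := by
  subst hq hn
  rw [sysComplex_d, sysComplex_d, Linear.smul_comp]
  apply ModuleCat.hom_ext
  apply TensorProduct.ext'
  intro f e
  change cup β p (q₀ + 1) (n₀ + 1) (((sysComplex M).iCycles p).hom f) (sysD N q₀ e) =
    ((-1 : A) ^ p.toNat) • sysD P n₀ (cup β p q₀ n₀ (((sysComplex M).iCycles p).hom f) e)
  by_cases hq₀ : 0 ≤ q₀
  · have hf : sysD M p (((sysComplex M).iCycles p).hom f) = 0 := by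
      have h := (sysComplex M).iCycles_d p (p + 1)
      rw [sysComplex_d] at h
      exact congrArg (fun f' => f'.hom f) h
    exact cup_sysD_right hβ hp hq₀ (by omega) hf e
  · haveI : Subsingleton ((sysComplex N).X q₀) := subsingleton_sysCochain_of_neg N (show q₀ < 0 by omega)
    rw [Subsingleton.elim e 0, map_zero, map_zero, map_zero, map_zero, smul_zero]

/-- **The cup product on cohomology, packaged**: the descended map
`Hᵖ(Č(M)) ⊗ Hᵠ(Č(N)) ⟶ Hⁿ(Č(P))` built by `bilinearHomologyMap` from (h1)–(h3) satisfies
`(π ⊗ π) ≫ cupH = (z ⊗ w ↦ [z ∪ w])` (restated here so that consumers see the full term once).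
[cite: Godement1958, II §6.6] [cite: CartanEilenberg1956, IV.6] -/
theorem homologyπ_tensor_cupHomology (hβ : IsNaturalPairing β) {p₀ p q₀ q n₀ n : ℤ} (hp : p₀ + 1 = p)
    (hq : q₀ + 1 = q) (hn : n₀ + 1 = n) (hp0 : 0 ≤ p) (hq0 : 0 ≤ q) (hpq : p + q = n) :
    ((sysComplex M).homologyπ p ⊗ₘ (sysComplex N).homologyπ q) ≫
      bilinearHomologyMap (sysComplex M) (sysComplex N) (sysComplex P) hp hq hn
        (ModuleCat.ofHom (lift (cup β p q n)) : (sysComplex M).X p ⊗ (sysComplex N).X q ⟶ (sysComplex P).X n)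
        (cupPairing_cycles hβ hp0 hq0 hpq) _ (cupPairing_boundary_left hβ hp hn hq0 hpq) _
        (cupPairing_boundary_right hβ hq hn hp0 hpq) =
      cyclesPairingToHomology (sysComplex M) (sysComplex N) (sysComplex P)
        (ModuleCat.ofHom (lift (cup β p q n))) (cupPairing_cycles hβ hp0 hq0 hpq) :=
  homologyπ_tensor_bilinearHomologyMap _ _ _ hp hq hn _ _ _ _ _ _

end OrderedCech

end Literature.Algebra.Homology

end
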